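import Summits.ResolutionOfSingularities.ResolutionOfSingularities.Theorems.EquisingularLiftEquisingularLiftNatEquinodalSectionOfVecStalk
import Summits.ResolutionOfSingularities.ResolutionOfSingularities.Theorems.EquisingularLiftEquisingularLiftNatEquinodalNodeRegularTaylor
import HarnessLib

/-!
# [OURS · L1 W4.5(b) · EL♮(3) · door ν4, brick N-0, core S8 — the NODE CHART IN THE STALK] dehomogenisation commutes with linear substitution, and
# the equinodal form read in `𝒪_{ℙ³_O, x}` through the chart `D₊(x_d)`

res-L1-w45b-stub-4 g13 (core S8 `SplitNodeAt`, piece (β)).  DEF-FREE; no `sorry`; standard axioms.  `--supports stmt-ResolutionOfSingularities-20148 --as helper`,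
counted 0.  EL♮(3) is NOT proved; resolution of singularities in positive characteristic is NOT proved.

* `eval₂_const_mul_of_isHomogeneous` — `F(c·y) = c^e F(y)` for a form of degree `e` (any `eval₂`);
* `val_fromZeroRingHom_algebraMap` — the scalar `c ∈ O` in `(O[x]_{x_d})₀` has value `C c / 1`;
* ★ `mk₁_aeval_linear_eq_eval₂` — DEHOMOGENISATION IS A RING MAP ON FORMS: for `G ∈ O[Y₀..Y_{m}]` homogeneous of degree `e` and linear forms `f_t`,
  `(G(f₀,…))/x_d^e = G(f₀/x_d, …)` in `(O[x]_{x_d})₀` (scalars through `O → (O[x]_{x_d})₀`), proved through the value map into `O[x]_{x_d}`.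
-/

set_option linter.dupNamespace false -- mandated namespace `Summit.<Summit>.<Problem>` of this single-conjunct summit

noncomputable section

open MvPolynomial HomogeneousLocalization
open Literature.AlgebraicGeometry.Resolution

namespace Summit.ResolutionOfSingularities.ResolutionOfSingularities.Cruxes.EquisingularLiftNat.Sections.Equinodal.SectionOfVec

universe u

variable {R : Type} [CommRing R] {n : ℕ}

/-- scaling the arguments of a form of degree `e` by `c` scales its `eval₂`-value by `c^e`. [folklore] -/
theorem eval₂_const_mul_of_isHomogeneous {S : Type*} [CommRing S] (φ : R →+* S) {σ : Type*} {F : MvPolynomial σ R} {e : ℕ}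
    (hF : F.IsHomogeneous e) (c : S) (y : σ → S) :
    eval₂ φ (fun i => c * y i) F = c ^ e * eval₂ φ y F := by
  classical
  conv_lhs => rw [← F.support_sum_monomial_coeff]
  conv_rhs => rw [← F.support_sum_monomial_coeff]
  rw [eval₂_sum, eval₂_sum, Finset.mul_sum]
  refine Finset.sum_congr rfl fun s hs => ?_
  rw [eval₂_monomial, eval₂_monomial, hF.degree_eq_sum_deg_support hs]
  simp only [Finsupp.prod, mul_pow, Finset.prod_mul_distrib, Finset.prod_pow_eq_pow_sum]
  ring

/-- the scalar `c ∈ R` of `(R[x]_{x_d})₀` has value `C c / 1` in `R[x]_{x_d}`. [folklore] -/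
theorem val_fromZeroRingHom_algebraMap (d : Fin (n + 1)) (c : R) :
    letI := MvPolynomial.gradedAlgebra (σ := Fin (n + 1)) (R := R)
    (HomogeneousLocalization.fromZeroRingHom (homogeneousSubmodule (Fin (n + 1)) R) (Submonoid.powers (X d : MvPolynomial (Fin (n + 1)) R))
        (algebraMap R (homogeneousSubmodule (Fin (n + 1)) R 0) c)).val =
      algebraMap (MvPolynomial (Fin (n + 1)) R) (Localization.Away (X d : MvPolynomial (Fin (n + 1)) R)) (C c) := by
  letI := MvPolynomial.gradedAlgebra (σ := Fin (n + 1)) (R := R)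
  rw [HomogeneousLocalization.fromZeroRingHom]
  simp only [RingHom.coe_mk, MonoidHom.coe_mk, OneHom.coe_mk, HomogeneousLocalization.val_mk]
  rw [Localization.mk_eq_mk', IsLocalization.mk'_eq_iff_eq_mul]
  simp [MvPolynomial.algebraMap_eq]

/-- ★ **DEHOMOGENISATION COMMUTES WITH LINEAR SUBSTITUTION.**  For `G ∈ R[Y]` homogeneous of degree `e` and linear forms `f_t ∈ R[x₀..xₙ]`:
`mk₁ e (G(f)) = eval₂ (scalars) (t ↦ mk₁ 1 f_t) G` in `(R[x]_{x_d})₀`. [folklore; through `val` into `R[x]_{x_d}` and `F(c·y) = c^e F(y)`] -/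
theorem mk₁_aeval_linear_eq_eval₂ (d : Fin (n + 1)) {τ : Type*} (f : τ → MvPolynomial (Fin (n + 1)) R)
    (hf : ∀ t, f t ∈ homogeneousSubmodule (Fin (n + 1)) R 1) (G : MvPolynomial τ R) {e : ℕ} (hG : G.IsHomogeneous e)
    (hGf : aeval f G ∈ homogeneousSubmodule (Fin (n + 1)) R e) :
    letI := MvPolynomial.gradedAlgebra (σ := Fin (n + 1)) (R := R)
    mk₁ (homogeneousSubmodule (Fin (n + 1)) R) (isHomogeneous_X R d) e (aeval f G) hGf =
      eval₂ ((HomogeneousLocalization.fromZeroRingHom (homogeneousSubmodule (Fin (n + 1)) R) (Submonoid.powers (X d : MvPolynomial (Fin (n + 1)) R))).comp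
          (algebraMap R (homogeneousSubmodule (Fin (n + 1)) R 0)))
        (fun t => mk₁ (homogeneousSubmodule (Fin (n + 1)) R) (isHomogeneous_X R d) 1 (f t) (hf t)) G := by
  letI := MvPolynomial.gradedAlgebra (σ := Fin (n + 1)) (R := R)
  classical
  apply HomogeneousLocalization.val_injective
  set Lx := Localization.Away (X d : MvPolynomial (Fin (n + 1)) R) with hLx
  set alg := algebraMap (MvPolynomial (Fin (n + 1)) R) Lx with halg
  set k := algebraMap (HomogeneousLocalization.Away (homogeneousSubmodule (Fin (n + 1)) R) (X d : MvPolynomial (Fin (n + 1)) R)) Lx with hkdef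
  have hk : ∀ q : HomogeneousLocalization.Away (homogeneousSubmodule (Fin (n + 1)) R) (X d : MvPolynomial (Fin (n + 1)) R), q.val = k q :=
    fun q => (HomogeneousLocalization.algebraMap_apply q).symm
  -- the value of the right side: push `val` through `eval₂`
  rw [hk (eval₂ _ _ G), eval₂_comp_left k]
  have hc : (k.comp ((HomogeneousLocalization.fromZeroRingHom (homogeneousSubmodule (Fin (n + 1)) R) (Submonoid.powers (X d : MvPolynomial (Fin (n + 1)) R))).comp
      (algebraMap R (homogeneousSubmodule (Fin (n + 1)) R 0)))) = alg.comp C := by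
    refine RingHom.ext fun c => ?_
    rw [RingHom.comp_apply, RingHom.comp_apply, RingHom.comp_apply, ← hk]
    exact val_fromZeroRingHom_algebraMap d c
  -- the inverse of `x_d`
  have hu : IsUnit (alg (X d)) := IsLocalization.Away.algebraMap_isUnit (X d : MvPolynomial (Fin (n + 1)) R)
  set w : Lx := IsLocalization.mk' Lx (1 : MvPolynomial (Fin (n + 1)) R) (⟨X d ^ 1, 1, rfl⟩ : Submonoid.powers (X d : MvPolynomial (Fin (n + 1)) R)) with hwdef
  have hw : w * alg (X d) = 1 := by
    have h := IsLocalization.mk'_spec Lx (1 : MvPolynomial (Fin (n + 1)) R) (⟨X d ^ 1, 1, rfl⟩ : Submonoid.powers (X d : MvPolynomial (Fin (n + 1)) R))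
    rw [map_one] at h
    have h' : w * alg (X d ^ 1) = 1 := h
    rwa [pow_one] at h'
  have hg : (k ∘ fun t => mk₁ (homogeneousSubmodule (Fin (n + 1)) R) (isHomogeneous_X R d) 1 (f t) (hf t)) = fun t => w * alg (f t) := by
    funext t
    rw [Function.comp_apply, ← hk, val_mk₁, Localization.mk_eq_mk', IsLocalization.mk'_eq_mul_mk'_one, mul_comm]
  rw [hc, hg, eval₂_const_mul_of_isHomogeneous (alg.comp C) hG w, show (fun t => alg (f t)) = (⇑alg ∘ f) from rfl,
    ← eval₂_comp_left alg C f G]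
  -- the value of the left side, and cancel the unit `x_d^e`
  have haev : aeval f G = eval₂ C f G := by rw [MvPolynomial.aeval_def, algebraMap_eq]
  rw [val_mk₁, ← haev, Localization.mk_eq_mk']
  apply (hu.pow e).mul_left_inj.mp
  rw [← map_pow, IsLocalization.mk'_spec, map_pow, mul_assoc, mul_left_comm, ← mul_pow, hw, one_pow, mul_one]

/-- two generators scaled by a unit span the same ideal. [folklore] -/
theorem span_pair_mul_isUnit {B : Type*} [CommRing B] (a b c : B) (hc : IsUnit c) :
    Ideal.span {a * c, b * c} = Ideal.span {a, b} := by
  apply le_antisymm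
  · rw [Ideal.span_le]
    rintro x (rfl | rfl)
    · exact Ideal.mul_mem_right _ _ (Ideal.subset_span (by simp))
    · exact Ideal.mul_mem_right _ _ (Ideal.subset_span (by simp))
  · rw [Ideal.span_le]
    rintro x (rfl | rfl)
    · exact (Ideal.mul_unit_mem_iff_mem _ hc).mp (Ideal.subset_span (by simp))
    · exact (Ideal.mul_unit_mem_iff_mem _ hc).mp (Ideal.subset_span (by simp))

/-- ★ **THE NODE TAYLOR EXPANSION, read through any ring map `ι₀ : O → B`.**  `G̃ ∈ O[Y₀,Y₁,Y₂]` homogeneous of degree `e` with an ordinary node at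
`n = (n₀, n₁, ·)` in the sense of ✓ `nodeChart_hypotheses` (the chart `G := G̃(X₀+n₀, X₁+n₁, 1)` has vanishing constant and linear coefficients and
`b² − 4ac` a unit); for `y : Fin 3 → B` with `y₂` a UNIT, putting `ū := y₀ − n₀y₂`, `v̄ := y₁ − n₁y₂`:
`G̃(y) = a ū² + b ū v̄ + c v̄² + h` with `h ∈ (ū, v̄)³` and `b² − 4ac` a unit (`a, b, c` = `y₂^e y₂⁻²` times the chart coefficients).
[folklore; `G̃(y) = y₂^e · G(ū/y₂, v̄/y₂)` + ✓ `NodeReg.sub_quadratic_mem_cube`] -/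
theorem node_taylor_eval₂ {O : Type} [CommRing O] {B : Type*} [CommRing B] (ι₀ : O →+* B)
    (Gt : MvPolynomial (Fin 3) O) {e : ℕ} (hGt : Gt.IsHomogeneous e) (nv : Fin 3 → O)
    (h00 : coeff 0 (aeval ![X 0 + C (nv 0), X 1 + C (nv 1), (1 : MvPolynomial (Fin 2) O)] Gt) = 0)
    (h10 : coeff (Finsupp.single 0 1) (aeval ![X 0 + C (nv 0), X 1 + C (nv 1), (1 : MvPolynomial (Fin 2) O)] Gt) = 0)
    (h01 : coeff (Finsupp.single 1 1) (aeval ![X 0 + C (nv 0), X 1 + C (nv 1), (1 : MvPolynomial (Fin 2) O)] Gt) = 0)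
    (hdisc : IsUnit (coeff (Finsupp.single 0 1 + Finsupp.single 1 1) (aeval ![X 0 + C (nv 0), X 1 + C (nv 1), (1 : MvPolynomial (Fin 2) O)] Gt) ^ 2
      - 4 * coeff (Finsupp.single 0 2) (aeval ![X 0 + C (nv 0), X 1 + C (nv 1), (1 : MvPolynomial (Fin 2) O)] Gt) * coeff (Finsupp.single 1 2) (aeval ![X 0 + C (nv 0), X 1 + C (nv 1), (1 : MvPolynomial (Fin 2) O)] Gt)))
    (y : Fin 3 → B) (hw : IsUnit (y 2)) :
    ∃ a b c h : B, eval₂ ι₀ y Gt = a * (y 0 - ι₀ (nv 0) * y 2) ^ 2 + b * (y 0 - ι₀ (nv 0) * y 2) * (y 1 - ι₀ (nv 1) * y 2) +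
        c * (y 1 - ι₀ (nv 1) * y 2) ^ 2 + h ∧
      h ∈ Ideal.span {y 0 - ι₀ (nv 0) * y 2, y 1 - ι₀ (nv 1) * y 2} ^ 3 ∧ IsUnit (b ^ 2 - 4 * a * c) := by
  classical
  set G := aeval ![X 0 + C (nv 0), X 1 + C (nv 1), (1 : MvPolynomial (Fin 2) O)] Gt with hGdef
  set winv : B := ↑(hw.unit⁻¹) with hwinv_def
  have hwinv : y 2 * winv = 1 := hw.mul_val_inv
  set u := y 0 - ι₀ (nv 0) * y 2 with hu
  set v := y 1 - ι₀ (nv 1) * y 2 with hv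
  set z : Fin 3 → B := ![u * winv + ι₀ (nv 0), v * winv + ι₀ (nv 1), 1] with hz
  have hyz : y = fun t => y 2 * z t := by
    funext t
    fin_cases t
    · show y 0 = y 2 * (u * winv + ι₀ (nv 0))
      linear_combination (-(y 0 - ι₀ (nv 0) * y 2)) * hwinv
    · show y 1 = y 2 * (v * winv + ι₀ (nv 1))
      linear_combination (-(y 1 - ι₀ (nv 1) * y 2)) * hwinv
    · show y 2 = y 2 * 1
      rw [mul_one]
  -- `G̃(y) = y₂^e · G̃(z)` and `G̃(z) = G(u/y₂, v/y₂)`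
  have hscale : eval₂ ι₀ y Gt = y 2 ^ e * eval₂ ι₀ z Gt := by
    conv_lhs => rw [hyz]
    exact eval₂_const_mul_of_isHomogeneous ι₀ hGt (y 2) z
  set q : Fin 2 → B := ![u * winv, v * winv] with hq
  have hzG : eval₂ ι₀ z Gt = eval₂ ι₀ q G := by
    have hb : G = bind₁ ![X 0 + C (nv 0), X 1 + C (nv 1), (1 : MvPolynomial (Fin 2) O)] Gt := by
      rw [hGdef, aeval_eq_bind₁]
    have hfun : (fun i => eval₂Hom ι₀ q (![X 0 + C (nv 0), X 1 + C (nv 1), (1 : MvPolynomial (Fin 2) O)] i)) = z := by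
      funext t
      fin_cases t
      · show eval₂Hom ι₀ q (X 0 + C (nv 0)) = z 0; simp [hz, hq]
      · show eval₂Hom ι₀ q (X 1 + C (nv 1)) = z 1; simp [hz, hq]
      · show eval₂Hom ι₀ q 1 = z 2; simp [hz]
    rw [hb, ← coe_eval₂Hom, ← coe_eval₂Hom, eval₂Hom_bind₁, hfun]
  -- Taylor at the node
  have hcube := NodeReg.sub_quadratic_mem_cube G h00 h10 h01
  set Q : MvPolynomial (Fin 2) O := C (coeff (Finsupp.single 0 2) G) * X 0 ^ 2 +
    C (coeff (Finsupp.single 0 1 + Finsupp.single 1 1) G) * X 0 * X 1 + C (coeff (Finsupp.single 1 2) G) * X 1 ^ 2 with hQ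
  have hrem : eval₂ ι₀ q (G - Q) ∈ Ideal.span {u, v} ^ 3 := by
    have h1 := Ideal.mem_map_of_mem (eval₂Hom ι₀ q) hcube
    rw [Ideal.map_pow, Ideal.map_span, Set.image_pair, coe_eval₂Hom, eval₂_X, eval₂_X] at h1
    have hspan : Ideal.span {q 0, q 1} = Ideal.span {u, v} := by
      rw [hq]
      exact span_pair_mul_isUnit u v winv (Units.isUnit _)
    rw [hspan] at h1
    exact h1
  have hQev : eval₂ ι₀ q Q = ι₀ (coeff (Finsupp.single 0 2) G) * (u * winv) ^ 2 +
      ι₀ (coeff (Finsupp.single 0 1 + Finsupp.single 1 1) G) * (u * winv) * (v * winv) + ι₀ (coeff (Finsupp.single 1 2) G) * (v * winv) ^ 2 := by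
    simp only [hQ, eval₂_add, eval₂_mul, eval₂_C, eval₂_pow, eval₂_X, hq, Matrix.cons_val_zero, Matrix.cons_val_one]
  have hGQ : eval₂ ι₀ q G = eval₂ ι₀ q Q + eval₂ ι₀ q (G - Q) := by rw [eval₂_sub]; ring
  refine ⟨y 2 ^ e * winv ^ 2 * ι₀ (coeff (Finsupp.single 0 2) G), y 2 ^ e * winv ^ 2 * ι₀ (coeff (Finsupp.single 0 1 + Finsupp.single 1 1) G),
    y 2 ^ e * winv ^ 2 * ι₀ (coeff (Finsupp.single 1 2) G), y 2 ^ e * eval₂ ι₀ q (G - Q), ?_, ?_, ?_⟩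
  · rw [hscale, hzG, hGQ, hQev]; ring
  · exact Ideal.mul_mem_left _ _ hrem
  · have hwu : IsUnit winv := Units.isUnit _
    have heq : (y 2 ^ e * winv ^ 2 * ι₀ (coeff (Finsupp.single 0 1 + Finsupp.single 1 1) G)) ^ 2 -
        4 * (y 2 ^ e * winv ^ 2 * ι₀ (coeff (Finsupp.single 0 2) G)) * (y 2 ^ e * winv ^ 2 * ι₀ (coeff (Finsupp.single 1 2) G)) =
        (y 2 ^ e * winv ^ 2) ^ 2 * ι₀ (coeff (Finsupp.single 0 1 + Finsupp.single 1 1) G ^ 2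
          - 4 * coeff (Finsupp.single 0 2) G * coeff (Finsupp.single 1 2) G) := by
      simp only [map_sub, map_mul, map_pow, map_ofNat]; ring
    rw [heq]
    exact (((hw.pow e).mul (hwu.pow 2)).pow 2).mul (hdisc.map ι₀)

end Summit.ResolutionOfSingularities.ResolutionOfSingularities.Cruxes.EquisingularLiftNat.Sections.Equinodal.SectionOfVec

end
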